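import Summits.AtomisticToContinuum.HydrodynamicLimit.Theses.GolfBallDice
import HarnessLib

/-!
# Birth skeleton for crux `GolfRealisation` (stmt-AtomisticToContinuum-13287) of route
`GolfBallDice` — line `birth`: EXACT COUPLING AS THE CURRENCY

The crux (rank 2, XL): there are a shape schedule `(Ψ_N, a_N, s_N)` and outgoing-supported,
flux-reciprocal Markov collision kernels `κ_N` with a uniform one-collision `L²(flux)` gap `q_N` in the
window `q_N (N+1)^{1/3} → ∞` such that, for all continuous positive profiles, `∃ σ₀ ∀ σ ∈ (0, σ₀)`:
(i) the `Ψ_N`-billiard (`HardSphereFlow` of the geometry `sepVec ↦ Ψ_N ∘ sepVec`) exists for every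
`N`, and (ii) for every `t ≥ 0` and continuous `χ` the laws of the `χ`-tested empirical density /
momentum / energy fields of the shape gas at time `t` (from its own local Gibbs law `P'_N`) and of the
kernel gas `HS(κ_N)` at time `t` (`Q_N t = kernelGasLawAt …`, started from the SPHERE local Gibbs law)
merge weakly (bounded continuous test functions).

The route's own two-layer plan reads `GolfFlowExists → StudKernel → ExactCoupling → GolfRealisation`,
the last arrow being "merging by the sup-distance between coupled configurations". This skeleton
types that last arrow and strips the two provable ends off the open core:

* `stub_golfCoupling` (LOAD-BEARING, XL — golf hardware + EXACT COUPLING, the natural currency of the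
  line): the same `∃ (Ψ, a, s) ∃ (κ, q)` prefix as the crux (schedule axioms and kernel axioms
  VERBATIM, so the witness is handed to the crux unchanged), the same flows-exist clause (i), and in
  place of (ii): for every family of shape flows `Φ'` and every `t ≥ 0` there are COUPLINGS `π_N` of
  `P'_N` and `Q_N t` (sub-probability measures on `Config × Config` with these two marginals exactly)
  and radii `δ_N → 0` such that `π_N{(z, z') | ¬ ∀ i, v_i(Φ'_N(t) z) = v_i(z') ∧ d_𝕋(x_i(Φ'_N(t) z), x_i(z')) ≤ δ_N} → 0`
  — at time `t` the shape gas and the kernel gas sit, with probability `→ 1`, on one probability space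
  with IDENTICAL velocities and `δ_N`-close positions (intended: `δ_N ≍ N^{4/3} s_N w_N + a_N ε_N`-type,
  from matched encounters with super-exponentially thin studs `w_N ≤ ε_N e^{-N²}`; exact marginals are
  available because both local Gibbs laws are probability laws for `σ(1 + a_N) < 1/2` and
  `kernelGasLawAt` is a genuine push-forward on the torus for `ε < 1/2`,
  `measurable_stochasticCollisionHardSphereProcess_torus`).
* `stub_shapeGasEnergyBound` (provable now, M/L): for EVERY measurable shape map family `Ψ`, every
  `σ` and continuous profiles `a₀, θ₀ > 0`, `u₀`, the normalised kinetic energy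
  `(N+1)⁻¹ Σ_i ‖v_i(Φ'(t) z)‖²` has `P'_N`-expectation (as a `lintegral`) bounded by ONE finite constant
  for all `N`, all shape flows `Φ'` of the `Ψ_N`-geometry and all `t` — energy conservation along
  hard-sphere trajectories of the `Ψ_N`-geometry (`configEnergy_collidePair` holds for every geometry;
  `particleLaw ≪ liouville`, good set conull) plus the Gaussian second moment
  `3 θ₀(x) + ‖u₀(x)‖² ≤ 3 max θ₀ + max ‖u₀‖²` of the local Maxwellian under the canonical law (mass `1`
  when `Z_N > 0`, the zero measure when `Z_N = 0`).
* `stub_mergingOfCoupled` (provable now, M/L, pure measure theory on the `(N+1)`-particle phase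
  spaces): sub-probability couplings `π_N` of `(μ_N, ν_N)` that are asymptotically exact in the above
  sense along measurable maps `S_N` (velocities of `S_N z` and `z'` equal, positions `δ_N`-close,
  `δ_N → 0`, off a `π_N`-small set) plus a uniform `lintegral` bound on `(N+1)⁻¹ Σ ‖v_i(S_N z)‖²` under
  `μ_N` give weak merging of the laws of the `χ`-tested empirical density / energy / momentum fields
  of `S_N z` under `μ_N` and of `z'` under `ν_N`, in exactly the crux's `(∀ Fr …) ∧ (∀ Fv …)` format
  (uniform continuity of `χ` on the compact torus — `dist ≤ Torus.euclidDist` —, Markov/Chebyshev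
  tightness from the energy bound, uniform continuity of the bounded continuous `F` on the resulting
  compact ranges, and `2‖F‖_∞ · π_N(bad)` for the rest).

`GolfRealisation_of : stub₁ → stub₂ → stub₃ → GolfRealisation` is the kernel-checked composition (the
crux BY NAME; hypotheses are the three stubs by their registered names, via the `Stubs.stub_…`
aliases, as in the sibling skeletons `ContactChaos/Lines/birth.lean`, `FastCollisionThroughput/…`):
witness handed through; `σ₀` from stub 1; for `(σ, Φ', t, χ)` take `(π, δ)` from stub 1 and `C` from
stub 2 and apply stub 3 with `μ_N := P'_N`, `ν_N := Q_N t`, `S_N := Φ'_N(t)` (measurable by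
`HardSphereFlow.measurable_flow`). `GolfRealisation_of_stubs : GolfRealisation` closes the crux modulo
the three sorried stubs. Sorries: exactly the three `stub_*` theorems.

Disproof used: none on file (`ledger crux ls stmt-AtomisticToContinuum-13287`: no workfiles, no
`Disproof.lean`, 2026-08-17); the refuter's crux-attack (Evidence13287.lean, 2026-08-15: SURVIVES;
"coupling caution on ring re-encounters") is honoured by keeping re-encounter freshness INSIDE the
load-bearing stub (it is the named risk of `stub_golfCoupling`, not assumed anywhere); no entry of
`ledger negatives --problem AtomisticToContinuum` is an instance of a stub (stubs 2–3 are soft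
measure theory; stub 1 is an existential about a NEW object, the studded pair body).
-/

namespace Summit.AtomisticToContinuum.HydrodynamicLimit.Cruxes.GolfRealisation.Birth

open MeasureTheory Filter Set
open scoped ENNReal Topology
open Literature.MathematicalPhysics.KineticTheory Literature.Analysis.FluidPDE
open Summit.AtomisticToContinuum.HydrodynamicLimit.Theses.GolfBallDice (GolfRealisation)

/-! ## §1 The stub statements (named `Prop`s) -/

/-- **Stub 1 — GOLF HARDWARE + EXACT COUPLING (load-bearing, XL).** Schedule and kernel prefix
verbatim the crux's; flows exist; and for every family of shape flows and every `t ≥ 0`,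
sub-probability couplings of the shape-gas initial law `P'_N` and the kernel-gas time-`t` law `Q_N t`
under which, off a set of `π_N`-measure `→ 0`, the time-`t` shape configuration and the kernel
configuration have identical velocities and `δ_N`-close positions, `δ_N → 0`. -/
def GolfCoupling : Prop :=
  ∃ (Ψ : ℕ → V3 → V3) (a s : ℕ → ℝ),
    ((∀ N, Measurable (Ψ N)) ∧ (∀ N r, Ψ N (-r) = -Ψ N r) ∧
      (∀ N (c : ℝ) r, 0 < c → Ψ N (c • r) = c • Ψ N r) ∧
      (∀ N r, (1 - a N) * ‖r‖ ≤ ‖Ψ N r‖ ∧ ‖Ψ N r‖ ≤ (1 + a N) * ‖r‖) ∧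
      (∀ N r, ‖(‖r‖) • Ψ N r - (‖Ψ N r‖) • r‖ ≤ s N * (‖r‖ * ‖Ψ N r‖)) ∧
      Tendsto a atTop (nhds 0) ∧ Tendsto s atTop (nhds 0)) ∧
    ∃ (κ : ℕ → CollisionKernel (Fin 3)) (_ : ∀ N, ProbabilityTheory.IsMarkovKernel (κ N)) (q : ℕ → ℝ),
      ((∀ N, IsOutgoingSupported (κ N)) ∧ (∀ N, IsFluxReciprocal (κ N)) ∧ (∀ N, 0 < q N ∧ q N ≤ 1) ∧
        (∀ N (ω : V3), ‖ω‖ = 1 → ∀ f : V3 → ℝ, Measurable f → (∀ n, |f n| ≤ 1) →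
          ∫ n, f n ∂(fluxOut ω) = 0 →
            ∫ g, (∫ n, f n ∂((κ N) (ω, g))) ^ 2 ∂(fluxIn ω) ≤ (1 - q N) * ∫ n, (f n) ^ 2 ∂(fluxOut ω)) ∧
        Tendsto (fun N : ℕ => q N * ((N : ℝ) + 1) ^ (1 / 3 : ℝ)) atTop atTop) ∧
      ∀ (a₀ θ₀ : T3 → ℝ) (u₀ : T3 → V3), Continuous a₀ → Continuous θ₀ → Continuous u₀ →
        (∀ x, 0 < a₀ x) → (∀ x, 0 < θ₀ x) →
        ∃ σ₀ : ℝ, 0 < σ₀ ∧ ∀ σ : ℝ, 0 < σ → σ < σ₀ →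
          let G₀ : Geometry (Fin 3) T3 := Torus.geometry (Fin 3)
          let ε : ℕ → ℝ := fun N => hsDiameter σ N
          let G : ℕ → Geometry (Fin 3) T3 := fun N =>
            ⟨G₀.translate, fun x y => Ψ N (G₀.sepVec x y), G₀.translate_zero, G₀.translate_add⟩
          (∀ N, Nonempty (HardSphereFlow (G N) (ε N) (N + 1))) ∧
          ∀ Φ' : (N : ℕ) → HardSphereFlow (G N) (ε N) (N + 1),
            let Q : (N : ℕ) → ℝ → Measure (Config (N + 1) (Fin 3) T3) := fun N t =>
              kernelGasLawAt (κ N) G₀ (ε N) (N + 1) ((liouville G₀ (N + 1) (ε N)).withDensity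
                (fun z => ENNReal.ofReal (canonicalDensity G₀ (ε N) (N + 1)
                  (localGibbsProfile a₀ u₀ θ₀) z))) t
            let P' : (N : ℕ) → Measure (Config (N + 1) (Fin 3) T3) := fun N =>
              particleLaw (Φ' N) (canonicalDensity (G N) (ε N) (N + 1) (localGibbsProfile a₀ u₀ θ₀))
            ∀ t : ℝ, 0 ≤ t →
              ∃ (π : (N : ℕ) → Measure (Config (N + 1) (Fin 3) T3 × Config (N + 1) (Fin 3) T3))
                (δ : ℕ → ℝ),
                (∀ N, π N Set.univ ≤ 1) ∧ (∀ N, (π N).fst = P' N) ∧ (∀ N, (π N).snd = Q N t) ∧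
                Tendsto δ atTop (nhds 0) ∧
                Tendsto (fun N => π N {p | ¬ ∀ i, ((Φ' N).flow t p.1 i).2 = (p.2 i).2 ∧
                  Torus.euclidDist ((Φ' N).flow t p.1 i).1 (p.2 i).1 ≤ δ N}) atTop (nhds 0)

/-- **Stub 2 — UNIFORM KINETIC-ENERGY BOUND FOR THE SHAPE GAS (provable now, M/L).** For every
measurable shape map family, every `σ` and continuous profiles `a₀, θ₀ > 0`, `u₀`: one finite
constant bounds `E_{P'_N}[(N+1)⁻¹ Σ_i ‖v_i(Φ'(t) z)‖²]` for all `N`, all shape flows `Φ'` of the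
`Ψ_N`-geometry at diameter `hsDiameter σ N`, all `t` (energy conservation + Gaussian moments). -/
def ShapeGasEnergyBound : Prop :=
  ∀ (Ψ : ℕ → V3 → V3), (∀ N, Measurable (Ψ N)) →
    ∀ (σ : ℝ) (a₀ θ₀ : T3 → ℝ) (u₀ : T3 → V3), Continuous a₀ → Continuous θ₀ → Continuous u₀ →
      (∀ x, 0 < a₀ x) → (∀ x, 0 < θ₀ x) →
      let G : ℕ → Geometry (Fin 3) T3 := fun N =>
        ⟨(Torus.geometry (Fin 3)).translate, fun x y => Ψ N ((Torus.geometry (Fin 3)).sepVec x y),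
          (Torus.geometry (Fin 3)).translate_zero, (Torus.geometry (Fin 3)).translate_add⟩
      ∃ C : ℝ≥0∞, C < ⊤ ∧
        ∀ (N : ℕ) (Φ' : HardSphereFlow (G N) (hsDiameter σ N) (N + 1)) (t : ℝ),
          ∫⁻ z, ENNReal.ofReal (((N : ℝ) + 1)⁻¹ * ∑ i, ‖(Φ'.flow t z i).2‖ ^ 2)
              ∂(particleLaw Φ' (canonicalDensity (G N) (hsDiameter σ N) (N + 1)
                (localGibbsProfile a₀ u₀ θ₀))) ≤ C

/-- **Stub 3 — MERGING OF ASYMPTOTICALLY COUPLED CONFIGURATION LAWS (provable now, M/L, pure measure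
theory).** Sub-probability couplings `π_N` of `(μ_N, ν_N)` along measurable maps `S_N`, asymptotically
exact (equal velocities, `δ_N`-close positions off a `π_N`-small set, `δ_N → 0`), plus a uniform bound
on the `μ_N`-expected normalised kinetic energy of `S_N z`, imply weak merging of the laws of the
`χ`-tested empirical density / energy / momentum fields, in the crux's format. -/
def MergingOfCoupled : Prop :=
  ∀ (μ ν : (N : ℕ) → Measure (Config (N + 1) (Fin 3) T3))
    (S : (N : ℕ) → Config (N + 1) (Fin 3) T3 → Config (N + 1) (Fin 3) T3)
    (π : (N : ℕ) → Measure (Config (N + 1) (Fin 3) T3 × Config (N + 1) (Fin 3) T3))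
    (δ : ℕ → ℝ) (C : ℝ≥0∞),
    (∀ N, Measurable (S N)) → (∀ N, π N Set.univ ≤ 1) → (∀ N, (π N).fst = μ N) →
      (∀ N, (π N).snd = ν N) → Tendsto δ atTop (nhds 0) →
      Tendsto (fun N => π N {p | ¬ ∀ i, (S N p.1 i).2 = (p.2 i).2 ∧
        Torus.euclidDist (S N p.1 i).1 (p.2 i).1 ≤ δ N}) atTop (nhds 0) →
      C < ⊤ →
      (∀ N, ∫⁻ z, ENNReal.ofReal (((N : ℝ) + 1)⁻¹ * ∑ i, ‖(S N z i).2‖ ^ 2) ∂(μ N) ≤ C) →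
      ∀ χ : T3 → ℝ, Continuous χ →
        (∀ Fr : ℝ → ℝ, Continuous Fr → (∃ M : ℝ, ∀ x, |Fr x| ≤ M) →
          Tendsto (fun N => (∫ z, Fr (empiricalDensityField (S N z) χ) ∂(μ N)) -
            ∫ z, Fr (empiricalDensityField z χ) ∂(ν N)) atTop (nhds 0) ∧
          Tendsto (fun N => (∫ z, Fr (empiricalEnergyField (S N z) χ) ∂(μ N)) -
            ∫ z, Fr (empiricalEnergyField z χ) ∂(ν N)) atTop (nhds 0)) ∧
        (∀ Fv : V3 → ℝ, Continuous Fv → (∃ M : ℝ, ∀ v, |Fv v| ≤ M) →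
          Tendsto (fun N => (∫ z, Fv (empiricalMomentumField (S N z) χ) ∂(μ N)) -
            ∫ z, Fv (empiricalMomentumField z χ) ∂(ν N)) atTop (nhds 0))

/-! The composing theorem may take a hypothesis only if its head constant is a registered obligation
or is NAMED like a declared stub; each statement is therefore mirrored by an alias
`Stubs.stub_X : Prop := X` (device of the sibling skeletons). -/
namespace Stubs

/-- Alias of stub 1, keyed by the registered name `stub_golfCoupling`. -/
abbrev stub_golfCoupling : Prop := GolfCoupling

/-- Alias of stub 2, keyed by the registered name `stub_shapeGasEnergyBound`. -/
abbrev stub_shapeGasEnergyBound : Prop := ShapeGasEnergyBound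

/-- Alias of stub 3, keyed by the registered name `stub_mergingOfCoupled`. -/
abbrev stub_mergingOfCoupled : Prop := MergingOfCoupled

end Stubs

/-! ## §2 Registered stubs (the open obligations; `sorry` ONLY here; signatures = the statements verbatim) -/

/-- **Stub 1** (= `GolfCoupling`: golf hardware + exact coupling; LOAD-BEARING, XL). -/
theorem stub_golfCoupling :
    ∃ (Ψ : ℕ → V3 → V3) (a s : ℕ → ℝ),
    ((∀ N, Measurable (Ψ N)) ∧ (∀ N r, Ψ N (-r) = -Ψ N r) ∧
      (∀ N (c : ℝ) r, 0 < c → Ψ N (c • r) = c • Ψ N r) ∧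
      (∀ N r, (1 - a N) * ‖r‖ ≤ ‖Ψ N r‖ ∧ ‖Ψ N r‖ ≤ (1 + a N) * ‖r‖) ∧
      (∀ N r, ‖(‖r‖) • Ψ N r - (‖Ψ N r‖) • r‖ ≤ s N * (‖r‖ * ‖Ψ N r‖)) ∧
      Tendsto a atTop (nhds 0) ∧ Tendsto s atTop (nhds 0)) ∧
    ∃ (κ : ℕ → CollisionKernel (Fin 3)) (_ : ∀ N, ProbabilityTheory.IsMarkovKernel (κ N)) (q : ℕ → ℝ),
      ((∀ N, IsOutgoingSupported (κ N)) ∧ (∀ N, IsFluxReciprocal (κ N)) ∧ (∀ N, 0 < q N ∧ q N ≤ 1) ∧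
        (∀ N (ω : V3), ‖ω‖ = 1 → ∀ f : V3 → ℝ, Measurable f → (∀ n, |f n| ≤ 1) →
          ∫ n, f n ∂(fluxOut ω) = 0 →
            ∫ g, (∫ n, f n ∂((κ N) (ω, g))) ^ 2 ∂(fluxIn ω) ≤ (1 - q N) * ∫ n, (f n) ^ 2 ∂(fluxOut ω)) ∧
        Tendsto (fun N : ℕ => q N * ((N : ℝ) + 1) ^ (1 / 3 : ℝ)) atTop atTop) ∧
      ∀ (a₀ θ₀ : T3 → ℝ) (u₀ : T3 → V3), Continuous a₀ → Continuous θ₀ → Continuous u₀ →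
        (∀ x, 0 < a₀ x) → (∀ x, 0 < θ₀ x) →
        ∃ σ₀ : ℝ, 0 < σ₀ ∧ ∀ σ : ℝ, 0 < σ → σ < σ₀ →
          let G₀ : Geometry (Fin 3) T3 := Torus.geometry (Fin 3)
          let ε : ℕ → ℝ := fun N => hsDiameter σ N
          let G : ℕ → Geometry (Fin 3) T3 := fun N =>
            ⟨G₀.translate, fun x y => Ψ N (G₀.sepVec x y), G₀.translate_zero, G₀.translate_add⟩
          (∀ N, Nonempty (HardSphereFlow (G N) (ε N) (N + 1))) ∧
          ∀ Φ' : (N : ℕ) → HardSphereFlow (G N) (ε N) (N + 1),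
            let Q : (N : ℕ) → ℝ → Measure (Config (N + 1) (Fin 3) T3) := fun N t =>
              kernelGasLawAt (κ N) G₀ (ε N) (N + 1) ((liouville G₀ (N + 1) (ε N)).withDensity
                (fun z => ENNReal.ofReal (canonicalDensity G₀ (ε N) (N + 1)
                  (localGibbsProfile a₀ u₀ θ₀) z))) t
            let P' : (N : ℕ) → Measure (Config (N + 1) (Fin 3) T3) := fun N =>
              particleLaw (Φ' N) (canonicalDensity (G N) (ε N) (N + 1) (localGibbsProfile a₀ u₀ θ₀))
            ∀ t : ℝ, 0 ≤ t →
              ∃ (π : (N : ℕ) → Measure (Config (N + 1) (Fin 3) T3 × Config (N + 1) (Fin 3) T3))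
                (δ : ℕ → ℝ),
                (∀ N, π N Set.univ ≤ 1) ∧ (∀ N, (π N).fst = P' N) ∧ (∀ N, (π N).snd = Q N t) ∧
                Tendsto δ atTop (nhds 0) ∧
                Tendsto (fun N => π N {p | ¬ ∀ i, ((Φ' N).flow t p.1 i).2 = (p.2 i).2 ∧
                  Torus.euclidDist ((Φ' N).flow t p.1 i).1 (p.2 i).1 ≤ δ N}) atTop (nhds 0) := by
  sorry

/-- **Stub 2** (= `ShapeGasEnergyBound`: uniform kinetic-energy bound for the shape gas; provable now). -/
theorem stub_shapeGasEnergyBound :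
    ∀ (Ψ : ℕ → V3 → V3), (∀ N, Measurable (Ψ N)) →
    ∀ (σ : ℝ) (a₀ θ₀ : T3 → ℝ) (u₀ : T3 → V3), Continuous a₀ → Continuous θ₀ → Continuous u₀ →
      (∀ x, 0 < a₀ x) → (∀ x, 0 < θ₀ x) →
      let G : ℕ → Geometry (Fin 3) T3 := fun N =>
        ⟨(Torus.geometry (Fin 3)).translate, fun x y => Ψ N ((Torus.geometry (Fin 3)).sepVec x y),
          (Torus.geometry (Fin 3)).translate_zero, (Torus.geometry (Fin 3)).translate_add⟩
      ∃ C : ℝ≥0∞, C < ⊤ ∧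
        ∀ (N : ℕ) (Φ' : HardSphereFlow (G N) (hsDiameter σ N) (N + 1)) (t : ℝ),
          ∫⁻ z, ENNReal.ofReal (((N : ℝ) + 1)⁻¹ * ∑ i, ‖(Φ'.flow t z i).2‖ ^ 2)
              ∂(particleLaw Φ' (canonicalDensity (G N) (hsDiameter σ N) (N + 1)
                (localGibbsProfile a₀ u₀ θ₀))) ≤ C := by
  sorry

/-- **Stub 3** (= `MergingOfCoupled`: merging of asymptotically coupled configuration laws; provable
now, pure measure theory). -/
theorem stub_mergingOfCoupled :
    ∀ (μ ν : (N : ℕ) → Measure (Config (N + 1) (Fin 3) T3))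
    (S : (N : ℕ) → Config (N + 1) (Fin 3) T3 → Config (N + 1) (Fin 3) T3)
    (π : (N : ℕ) → Measure (Config (N + 1) (Fin 3) T3 × Config (N + 1) (Fin 3) T3))
    (δ : ℕ → ℝ) (C : ℝ≥0∞),
    (∀ N, Measurable (S N)) → (∀ N, π N Set.univ ≤ 1) → (∀ N, (π N).fst = μ N) →
      (∀ N, (π N).snd = ν N) → Tendsto δ atTop (nhds 0) →
      Tendsto (fun N => π N {p | ¬ ∀ i, (S N p.1 i).2 = (p.2 i).2 ∧
        Torus.euclidDist (S N p.1 i).1 (p.2 i).1 ≤ δ N}) atTop (nhds 0) →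
      C < ⊤ →
      (∀ N, ∫⁻ z, ENNReal.ofReal (((N : ℝ) + 1)⁻¹ * ∑ i, ‖(S N z i).2‖ ^ 2) ∂(μ N) ≤ C) →
      ∀ χ : T3 → ℝ, Continuous χ →
        (∀ Fr : ℝ → ℝ, Continuous Fr → (∃ M : ℝ, ∀ x, |Fr x| ≤ M) →
          Tendsto (fun N => (∫ z, Fr (empiricalDensityField (S N z) χ) ∂(μ N)) -
            ∫ z, Fr (empiricalDensityField z χ) ∂(ν N)) atTop (nhds 0) ∧
          Tendsto (fun N => (∫ z, Fr (empiricalEnergyField (S N z) χ) ∂(μ N)) -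
            ∫ z, Fr (empiricalEnergyField z χ) ∂(ν N)) atTop (nhds 0)) ∧
        (∀ Fv : V3 → ℝ, Continuous Fv → (∃ M : ℝ, ∀ v, |Fv v| ≤ M) →
          Tendsto (fun N => (∫ z, Fv (empiricalMomentumField (S N z) χ) ∂(μ N)) -
            ∫ z, Fv (empiricalMomentumField z χ) ∂(ν N)) atTop (nhds 0)) := by
  sorry

/-- The registered theorems, the `Stubs` aliases and the named `Prop`s are the same statements. -/
example : Stubs.stub_golfCoupling := stub_golfCoupling
example : Stubs.stub_shapeGasEnergyBound := stub_shapeGasEnergyBound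
example : Stubs.stub_mergingOfCoupled := stub_mergingOfCoupled
example : GolfCoupling = Stubs.stub_golfCoupling := rfl
example : ShapeGasEnergyBound = Stubs.stub_shapeGasEnergyBound := rfl
example : MergingOfCoupled = Stubs.stub_mergingOfCoupled := rfl

/-! ## §3 Composition (sorry-free): the three stubs ⟹ the crux BY NAME -/

/-- **THE SKELETON THEOREM**: stub 1 → stub 2 → stub 3 → `GolfBallDice.GolfRealisation` (the crux BY
NAME; hypotheses = the three registered stubs by name, via their `Stubs` aliases). The schedule /
kernel witness of stub 1 is handed to the crux unchanged; `σ₀` is stub 1's; for `σ < σ₀` the flows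
exist by stub 1; for a family of shape flows `Φ'`, `t ≥ 0` and `χ`, take the couplings `(π_N, δ_N)`
of stub 1 and the energy constant `C` of stub 2 (at `Ψ`, `σ`, the profiles) and apply stub 3 with
`μ_N := P'_N`, `ν_N := Q_N t`, `S_N := Φ'_N(t)` (measurable: `HardSphereFlow.measurable_flow`). -/
theorem GolfRealisation_of :
    Stubs.stub_golfCoupling → Stubs.stub_shapeGasEnergyBound → Stubs.stub_mergingOfCoupled →
      GolfRealisation := by
  intro h₁ h₂ h₃
  obtain ⟨Ψ, a, s, hS, κ, hκM, q, hK, H⟩ := h₁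
  refine ⟨Ψ, a, s, hS, κ, hκM, q, hK, ?_⟩
  intro a₀ θ₀ u₀ ha hθ hu ha0 hθ0
  obtain ⟨σ₀, hσ₀, H'⟩ := H a₀ θ₀ u₀ ha hθ hu ha0 hθ0
  refine ⟨σ₀, hσ₀, fun σ hσ hσ' => ?_⟩
  obtain ⟨hne, HC⟩ := H' σ hσ hσ'
  refine ⟨hne, fun Φ' => ?_⟩
  intro Q P' t ht χ hχ
  obtain ⟨π, δ, hmass, hfst, hsnd, hδ, hbad⟩ := HC Φ' t ht
  obtain ⟨C, hC, hb⟩ := h₂ Ψ hS.1 σ a₀ θ₀ u₀ ha hθ hu ha0 hθ0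
  exact h₃ P' (fun N => Q N t) (fun N => (Φ' N).flow t) π δ C (fun N => (Φ' N).measurable_flow t)
    hmass hfst hsnd hδ hbad hC (fun N => hb N (Φ' N) t) χ hχ

/-- **The line's closing theorem, modulo the three registered stubs** (sorry-free once they are). -/
theorem GolfRealisation_of_stubs : GolfRealisation :=
  GolfRealisation_of stub_golfCoupling stub_shapeGasEnergyBound stub_mergingOfCoupled

end Summit.AtomisticToContinuum.HydrodynamicLimit.Cruxes.GolfRealisation.Birth
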